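import Mathlib
import Summits.Schanuel.Schanuel.Theorems.DiophantineDichotomyKhovanskiiApproxTypeEvLambertChallengerDist
import HarnessLib

/-!
# Route `DiophantineDichotomy`, crux `KhovanskiiApproxTypeEv` (stmt-Schanuel-14972), line `lambert-liouville-kill`:
# stub `stub_anchoredDist` — sup-norm distance of the anchored Lambert challenger `(1, β, p/q, α, −1, q/(kp))`

Crux `Summit.Schanuel.Schanuel.Theses.DiophantineDichotomy.KhovanskiiApproxTypeEv` (item stmt-Schanuel-14972),
certificate line `lambert-liouville-kill` (skeleton `Cruxes/KhovanskiiApproxTypeEv/Lines/lambert_liouville_kill.lean`,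
lead `prover-line-stmt-Schanuel-14972-a1-0`), registered stub `stub_anchoredDist` (landed `--supports stmt-Schanuel-14972`).

STUB 10 of the rank-3 (anchored) certificate `notLiouville_lambert_of_evAnchored`: at the anchored free
Khovanskii point `θ = (1, iπ, x, e, e^{iπ} = −1, eˣ)` with `k x eˣ = 1` (so `eˣ = 1/(kx)`), the combined
challenger `γ = (1, γ₂ 0, p/q, γ₂ 1, −1, q/(kp))` with `x/2 ≤ p/q` satisfies, in the sup (pi) norm on
`Fin 3 ⊕ Fin 3 → ℂ`, `‖γ − θ‖ ≤ max ‖γ₂ − (iπ, e)‖ ((1 + 2/(kx²)) |x − p/q|)`.  Coordinatewise: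
the anchor slots `1 − 1` and `−1 − e^{iπ}` vanish (`Complex.exp_pi_mul_I`), the pair slots
`γ₂ 0 − iπ`, `γ₂ 1 − e` are coordinates of `γ₂ − (iπ, e)` (`norm_le_pi_norm`), and the two Lambert
slots are those of STUB 5 (`stub_challengerDist`): `|p/q − x| ≤ (1 + 2/(kx²)) |x − p/q|`
(`abs_sub_le_lambertFactor_mul`) and `|q/(kp) − eˣ| = |1/(k (p/q)) − 1/(kx)| ≤ (1 + 2/(kx²)) |x − p/q|`
(`abs_inv_sub_inv_le_lambertFactor_mul`).  Mathlib + the landed STUB 5 helpers only. [folklore]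
-/

noncomputable section

-- `Summit.Schanuel.Schanuel.…` is the mandated summit/sub-problem namespace (single-conjunct summit), hence:
set_option linter.dupNamespace false

namespace Summit.Schanuel.Schanuel.Cruxes.KhovanskiiApproxTypeEv.LambertLiouvilleKill

open Polynomial

/-- **STUB 10 (distance of the combined challenger).**  `θ = (1, iπ, x, e, e^{iπ} = −1, eˣ = 1/(kx))`
(from `k x eˣ = 1`), `γ = (1, γ₂ 0, p/q, γ₂ 1, −1, q/(kp))` with `x/2 ≤ p/q`: in the sup norm
`‖γ − θ‖ ≤ max ‖γ₂ − (iπ, e)‖ ((1 + 2/(kx²)) |x − p/q|)`.  The anchor slots contribute `0`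
(`e^{iπ} = −1`), the pair slots `≤ ‖γ₂ − (iπ, e)‖` (coordinates of a pi-norm), the Lambert slots
`≤ (1 + 2/(kx²)) |x − p/q|` exactly as in STUB 5.  Proof: `pi_norm_le_iff_of_nonneg`, then the six
coordinates separately, the two real ones pushed to `ℝ` via `Complex.ofReal_exp`/`Complex.norm_real`.
[folklore] -/
theorem stub_anchoredDist :
    ∀ (k p q : ℕ) (x : ℝ) (γ₂ : Fin 2 → ℂ), 1 ≤ k → 0 < x → (k : ℝ) * x * Real.exp x = 1 → 1 ≤ p →
      1 ≤ q → x / 2 ≤ (p : ℝ) / q →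
      ‖Sum.elim ![(1 : ℂ), γ₂ 0, (p : ℂ) / q] ![γ₂ 1, -1, (q : ℂ) / (k * p)] -
          Sum.elim ![(1 : ℂ), Complex.I * Real.pi, (x : ℂ)]
            (Complex.exp ∘ ![(1 : ℂ), Complex.I * Real.pi, (x : ℂ)])‖ ≤
        max ‖γ₂ - ![Complex.I * Real.pi, Complex.exp 1]‖
          ((1 + 2 / ((k : ℝ) * x ^ 2)) * |x - (p : ℝ) / q|) := by
  intro k p q x γ₂ hk hx0 hx hp hq hwin
  have hkpos : (0 : ℝ) < k := by exact_mod_cast (show 0 < k by omega)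
  have hppos : (0 : ℝ) < p := by exact_mod_cast (show 0 < p by omega)
  have hqpos : (0 : ℝ) < q := by exact_mod_cast (show 0 < q by omega)
  -- `eˣ = 1/(kx)`
  have hexp : Real.exp x = 1 / ((k : ℝ) * x) := by
    rw [eq_div_iff (by positivity)]
    linarith [hx]
  -- `q/(kp) = 1/(k (p/q))`
  have hslot : (q : ℝ) / (k * p) = 1 / ((k : ℝ) * ((p : ℝ) / q)) := by
    field_simp
  -- the two `γ₂`-slots are coordinates of `γ₂ − (iπ, e)`
  have hpair0 : ‖γ₂ 0 - Complex.I * Real.pi‖ ≤ ‖γ₂ - ![Complex.I * Real.pi, Complex.exp 1]‖ := by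
    have h := norm_le_pi_norm (γ₂ - ![Complex.I * Real.pi, Complex.exp 1]) 0
    rwa [Pi.sub_apply, Matrix.cons_val_zero] at h
  have hpair1 : ‖γ₂ 1 - Complex.exp 1‖ ≤ ‖γ₂ - ![Complex.I * Real.pi, Complex.exp 1]‖ := by
    have h := norm_le_pi_norm (γ₂ - ![Complex.I * Real.pi, Complex.exp 1]) 1
    rwa [Pi.sub_apply, Matrix.cons_val_one, Matrix.cons_val_zero] at h
  -- the exact anchor slot: `e^{iπ} = −1`
  have hanchor : Complex.exp (Complex.I * Real.pi) = -1 := by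
    rw [mul_comm]
    exact Complex.exp_pi_mul_I
  have hR : 0 ≤ max ‖γ₂ - ![Complex.I * Real.pi, Complex.exp 1]‖
      ((1 + 2 / ((k : ℝ) * x ^ 2)) * |x - (p : ℝ) / q|) :=
    (norm_nonneg _).trans (le_max_left _ _)
  refine (pi_norm_le_iff_of_nonneg hR).mpr ?_
  rintro (i | i) <;> fin_cases i
  · -- slot `inl 0`: `1 − 1 = 0`
    simp only [Fin.zero_eta, Fin.isValue, Pi.sub_apply, Sum.elim_inl, Matrix.cons_val_zero, sub_self,
      norm_zero]
    exact hR
  · -- slot `inl 1`: `γ₂ 0 − iπ`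
    refine le_max_of_le_left ?_
    simp only [Fin.mk_one, Fin.isValue, Pi.sub_apply, Sum.elim_inl, Matrix.cons_val_one,
      Matrix.cons_val_zero]
    exact hpair0
  · -- slot `inl 2`: `p/q − x`
    refine le_max_of_le_right ?_
    have hcast : ((p : ℂ) / q - (x : ℂ)) = (((p : ℝ) / q - x : ℝ) : ℂ) := by push_cast; rfl
    simp only [Fin.reduceFinMk, Pi.sub_apply, Sum.elim_inl, Matrix.cons_val]
    rw [hcast, Complex.norm_real, Real.norm_eq_abs]
    exact abs_sub_le_lambertFactor_mul k x _ hkpos.le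
  · -- slot `inr 0`: `γ₂ 1 − e`
    refine le_max_of_le_left ?_
    simp only [Fin.zero_eta, Fin.isValue, Pi.sub_apply, Sum.elim_inr, Matrix.cons_val_zero,
      Function.comp_apply]
    exact hpair1
  · -- slot `inr 1`: `−1 − e^{iπ} = 0`
    simp only [Fin.mk_one, Fin.isValue, Pi.sub_apply, Sum.elim_inr, Matrix.cons_val_one,
      Matrix.cons_val_zero, Function.comp_apply, hanchor, sub_self, norm_zero]
    exact hR
  · -- slot `inr 2` (Lambert slot): `q/(kp) − eˣ`
    refine le_max_of_le_right ?_
    have hcast : ((q : ℂ) / (k * p) - Complex.exp (x : ℂ)) =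
        (((q : ℝ) / (k * p) - Real.exp x : ℝ) : ℂ) := by
      push_cast
      rfl
    simp only [Fin.reduceFinMk, Pi.sub_apply, Sum.elim_inr, Matrix.cons_val, Function.comp_apply]
    rw [hcast, Complex.norm_real, Real.norm_eq_abs, hslot, hexp]
    exact abs_inv_sub_inv_le_lambertFactor_mul k x _ hkpos hx0 hwin

end Summit.Schanuel.Schanuel.Cruxes.KhovanskiiApproxTypeEv.LambertLiouvilleKill

end
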